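import Literature.Analysis.FluidPDE.BiotSavartIdentities
import Literature.Analysis.FluidPDE.FracLaplacianCurl
import Literature.Analysis.FluidPDE.FracNSStability
import Literature.Analysis.FluidPDE.DeRosaGluedTriple
import HarnessLib

/-!
# De Rosa's gluing stage, Prop. 5.4: the equation of the vector potential `z̃ = ℬ(vᵢ - v_ℓ)`

L. De Rosa, *Infinitely many Leray–Hopf solutions for the fractional Navier–Stokes equations*,
Comm. PDE 44 (2019) 335–365 = arXiv:1801.10235, §5.2, proof of Prop. 5.4 (p. 13): with
`z̃ᵢ = ℬ(vᵢ - v_ℓ)` ("`div z̃ᵢ = 0`, `curl z̃ᵢ = vᵢ - v_ℓ`", (5.22)), the difference equation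
"`∂ₜ(v_ℓ - vᵢ) + v_ℓ·∇(v_ℓ - vᵢ) + ν(-Δ)^γ(v_ℓ - vᵢ) = -(v_ℓ - vᵢ)·∇vᵢ - ∇(p_ℓ - pᵢ) + div R̊_ℓ`" is
rewritten as the curl of an equation for `z̃ᵢ` ("`v_ℓ·∇(vᵢ - v_ℓ) = curl((v_ℓ·∇)z̃ᵢ) + div((z̃ᵢ×∇)v_ℓ)`",
"`((vᵢ - v_ℓ)·∇)vᵢ = div((z̃ᵢ×∇)vᵢ)`", "Taking the curl … the pressure term drops out"), so that
`∂ₜz̃ᵢ + (v_ℓ·∇)z̃ᵢ + ν(-Δ)^γ z̃ᵢ` is a sum of order `-1` operators applied to products of `z̃ᵢ`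
with first derivatives of `v_ℓ, vᵢ` and to `R̊_ℓ` ((5.27)–(5.28)).

This file proves that equation for the accepted objects (`Torus.IsFracNSReynoldsOn`,
`BDSV.biotSavart`), in the form obtained from the Helmholtz reconstruction
`Y = ∫Y + ℬ(curl Y) + ∇Δ⁻¹(div Y)` (`BDSV.eq_biotSavart_curl_add`) of
`Y = ∂ₜz̃ + (v_ℓ·∇)z̃ + ν(-Δ)^γ z̃`:

* `DeRosa.fracPotential_curl_eq` — `curl z̃ = w := vᵢ - v_ℓ` on the life span (`w` is smooth,
  divergence free and mean free: momentum conservation and the anchoring `vᵢ(t₀) = v_ℓ(t₀)`);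
* `DeRosa.fracPotential_curl_transport` — `curl Y = ∂ₜw + (v_ℓ·∇)w + ν(-Δ)^γ w + C₁`, with the
  first-order correction `C₁ = curl((v_ℓ·∇)z̃) - (v_ℓ·∇)curl z̃` of `BDSV.curl_convect`;
* `DeRosa.fracPotential_integral_transport`, `DeRosa.fracPotential_divergence_transport` — `∫Y = 0`
  and `div Y = div((z̃·∇)v_ℓ)`;
* `DeRosa.fracPotential_transport_eq` — **the equation of the potential**:
  `∂ₜz̃ + (v_ℓ·∇)z̃ + ν(-Δ)^γ z̃ = -ℬ((w·∇)vᵢ) - ℬ(div R̊_ℓ) + ℬ(C₁) + ∇Δ⁻¹div((z̃·∇)v_ℓ)`.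

## References

* L. De Rosa, Comm. PDE 44 (2019) = arXiv:1801.10235, §5.2 Prop. 5.4 and its proof ((5.22),
  (5.26)–(5.28)). [`Derosa2018`]
* T. Buckmaster, C. De Lellis, L. Székelyhidi Jr., V. Vicol, CPAM 72 (2019) = arXiv:1701.08678,
  §3.3, proof of Prop. 3.4. [`BuckmasterEtAl2018`]
-/

noncomputable section

open MeasureTheory Set Filter Function
open scoped ContDiff

namespace Literature.Analysis.FluidPDE

namespace DeRosa

open FunctionSpaces FunctionSpaces.Torus
open BDSV hiding IsGlueFamily

variable {a b γ ν : ℝ} {vℓ v w Z : ℝ → UnitAddTorus (Fin 3) → EuclideanSpace ℝ (Fin 3)}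
  {pℓ p : ℝ → UnitAddTorus (Fin 3) → ℝ} {Rℓ : ℝ → UnitAddTorus (Fin 3) → Fin 3 → EuclideanSpace ℝ (Fin 3)}

/-- A vector field on `𝕋³` given by three smooth coordinate functions is smooth. [folklore] -/
theorem isSmooth_vec3 {A B C : UnitAddTorus (Fin 3) → ℝ} (hA : IsSmooth A) (hB : IsSmooth B) (hC : IsSmooth C) :
    IsSmooth (fun y => (WithLp.toLp 2 ![A y, B y, C y] : EuclideanSpace ℝ (Fin 3))) := by
  refine Torus.isSmooth_euclidean_iff.2 fun j => ?_
  fin_cases j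
  · simpa using hA
  · simpa using hB
  · simpa using hC

section Setting

/-! ### The setting: `w = vᵢ - v_ℓ`, `z̃ = ℬw` -/

variable (hab : a < b) (hγ : 0 < γ) (hℓ : Torus.IsFracNSReynoldsOn (Icc a b) γ ν vℓ pℓ Rℓ)
  (hv : Torus.IsFracNSReynoldsOn (Icc a b) γ ν v p (fun _ _ _ => 0)) (hanchor : v a = vℓ a)
  (hwdef : ∀ t y, w t y = v t y - vℓ t y) (hZdef : ∀ t, Z t = BDSV.biotSavart (w t))

include hwdef in
/-- `w = vᵢ - v_ℓ` as a function. [folklore] -/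
theorem fracPotential_w_eq : w = fun t y => v t y - vℓ t y := funext fun t => funext fun y => hwdef t y

include hℓ hv hwdef in
/-- `w = vᵢ - v_ℓ` is jointly smooth. [folklore] -/
theorem fracPotential_smooth_w : FunctionSpaces.Torus.IsSmoothSpaceTimeOn (Icc a b) w := by
  rw [fracPotential_w_eq hwdef]
  exact hv.smooth_velocity.sub hℓ.smooth_velocity

include hab hℓ hv hwdef hZdef in
/-- `z̃ = ℬw` is jointly smooth. [folklore] -/
theorem fracPotential_smooth_Z : FunctionSpaces.Torus.IsSmoothSpaceTimeOn (Icc a b) Z := by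
  have hint : (interior (Icc a b)).Nonempty := by rw [interior_Icc]; exact nonempty_Ioo.2 hab
  rw [show Z = fun t => BDSV.biotSavart (w t) from funext hZdef]
  exact isSmoothSpaceTimeOn_biotSavart (fracPotential_smooth_w hℓ hv hwdef) (convex_Icc a b) hint

include hℓ hv hwdef in
/-- `w` is divergence free. [folklore] -/
theorem fracPotential_isDivFree_w {t : ℝ} (ht : t ∈ Icc a b) : IsDivFree (w t) := by
  rw [show w t = fun y => v t y - vℓ t y from funext (hwdef t)]
  exact fracStability_isDivFree_sub hℓ hv ht

include hγ hℓ hv hanchor hwdef in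
/-- `w` is mean free: `∫(vᵢ - v_ℓ)(t) = ∫vᵢ(t₀) - ∫v_ℓ(t₀) = 0` (momentum conservation of both systems
and the anchoring). [cite: Derosa2018, §5.2 (5.9), (5.22)] -/
theorem fracPotential_integral_w {t : ℝ} (ht : t ∈ Icc a b) : ∫ y, w t y = 0 := by
  have hab' : a ≤ b := le_trans ht.1 ht.2
  have ha : a ∈ Icc a b := left_mem_Icc.2 hab'
  rw [show w t = fun y => v t y - vℓ t y from funext (hwdef t),
    integral_sub ((hv.smooth_velocity.isSmooth_slice ht).integrable) ((hℓ.smooth_velocity.isSmooth_slice ht).integrable),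
    hv.integral_velocity_eq hγ ht ha, hℓ.integral_velocity_eq hγ ht ha, hanchor, sub_self]

include hγ hℓ hv hanchor hwdef hZdef in
/-- **`curl z̃ = w`** ((5.22): "`curl zᵢ = vᵢ - ∫vᵢ`", and `w` is mean free). [cite: Derosa2018, §5.2 (5.22)] -/
theorem fracPotential_curl_eq {t : ℝ} (ht : t ∈ Icc a b) : BDSV.curl (Z t) = w t := by
  have hwt : IsSmooth (w t) := by
    rw [show w t = fun y => v t y - vℓ t y from funext (hwdef t)]
    exact (hv.smooth_velocity.isSmooth_slice ht).sub (hℓ.smooth_velocity.isSmooth_slice ht)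
  rw [hZdef t]
  exact curl_biotSavart_of_integral_eq_zero hwt (fracPotential_isDivFree_w hℓ hv hwdef ht)
    (fracPotential_integral_w hγ hℓ hv hanchor hwdef ht)

end Setting

/-! ### The equation -/

/-- **The curl of the transport of the potential**: with `w = vᵢ - v_ℓ`, `z̃ = ℬw`,
`curl(∂ₜz̃ + (v_ℓ·∇)z̃ + ν(-Δ)^γ z̃) = ∂ₜw + (v_ℓ·∇)w + ν(-Δ)^γ w + C₁` on `[a,b] × 𝕋³`, where
`C₁ = curl((v_ℓ·∇)z̃) - (v_ℓ·∇)(curl z̃)` is the first-order correction of `BDSV.curl_convect`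
(`∂ₜ`, `(-Δ)^γ` commute with `curl`; `curl z̃ = w`). [cite: Derosa2018, §5.2 proof of Prop. 5.4] -/
theorem fracPotential_curl_transport (hab : a < b) (hγ : 0 < γ) (hℓ : Torus.IsFracNSReynoldsOn (Icc a b) γ ν vℓ pℓ Rℓ)
    (hv : Torus.IsFracNSReynoldsOn (Icc a b) γ ν v p (fun _ _ _ => 0)) (hanchor : v a = vℓ a)
    (hwdef : ∀ t y, w t y = v t y - vℓ t y) (hZdef : ∀ t, Z t = BDSV.biotSavart (w t))
    {s : ℝ} (hs : s ∈ Icc a b) (x : UnitAddTorus (Fin 3)) :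
    BDSV.curl (fun y => FunctionSpaces.Torus.timeDerivWithin (Icc a b) Z s y + FunctionSpaces.Torus.convect (vℓ s) (Z s) y + ν • Torus.fracLaplacian γ (Z s) y) x =
      FunctionSpaces.Torus.timeDerivWithin (Icc a b) w s x + FunctionSpaces.Torus.convect (vℓ s) (w s) x + ν • Torus.fracLaplacian γ (w s) x +
        (BDSV.curl (FunctionSpaces.Torus.convect (vℓ s) (Z s)) x - FunctionSpaces.Torus.convect (vℓ s) (BDSV.curl (Z s)) x) := by
  have hU : UniqueDiffOn ℝ (Icc a b) := uniqueDiffOn_Icc hab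
  have hZs : FunctionSpaces.Torus.IsSmoothSpaceTimeOn (Icc a b) Z := fracPotential_smooth_Z hab hℓ hv hwdef hZdef
  have hZss : IsSmooth (Z s) := hZs.isSmooth_slice hs
  have hℓs : IsSmooth (vℓ s) := hℓ.smooth_velocity.isSmooth_slice hs
  have h1 : IsSmooth (FunctionSpaces.Torus.timeDerivWithin (Icc a b) Z s) := hZs.isSmooth_timeDerivWithin hU hs
  have h2 : IsSmooth (FunctionSpaces.Torus.convect (vℓ s) (Z s)) := hℓs.convect hZss
  have h3 : IsSmooth (Torus.fracLaplacian γ (Z s)) := hZss.fracLaplacian hγ.le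
  have h3' : IsSmooth (ν • Torus.fracLaplacian γ (Z s)) := h3.smul ν
  rw [show (fun y => FunctionSpaces.Torus.timeDerivWithin (Icc a b) Z s y + FunctionSpaces.Torus.convect (vℓ s) (Z s) y + ν • Torus.fracLaplacian γ (Z s) y) =
      (FunctionSpaces.Torus.timeDerivWithin (Icc a b) Z s + FunctionSpaces.Torus.convect (vℓ s) (Z s)) + ν • Torus.fracLaplacian γ (Z s) from rfl,
    curl_add ((h1.add h2).isContDiff (by simp)) (h3'.isContDiff (by simp)),
    curl_add (h1.isContDiff (by simp)) (h2.isContDiff (by simp)),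
    curl_const_smul (h3.isContDiff (by simp)), curl_fracLaplacian_comm hγ.le hZss x,
    ← timeDerivWithin_curl_comm hab hZs hs x]
  -- `∂ₜ curl z̃ = ∂ₜ w` and `curl z̃ = w` at time `s`
  have hcurl : ∀ t ∈ Icc a b, BDSV.curl (Z t) = w t := fun t ht => fracPotential_curl_eq hγ hℓ hv hanchor hwdef hZdef ht
  have e1 : FunctionSpaces.Torus.timeDerivWithin (Icc a b) (fun t => BDSV.curl (Z t)) s x = FunctionSpaces.Torus.timeDerivWithin (Icc a b) w s x := by
    unfold FunctionSpaces.Torus.timeDerivWithin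
    exact derivWithin_congr (fun t ht => by simp only [hcurl t ht]) (by simp only [hcurl s hs])
  rw [e1, hcurl s hs]
  abel

/-- **`∫(∂ₜz̃ + (v_ℓ·∇)z̃ + ν(-Δ)^γ z̃) = 0`**: `∫z̃ ≡ 0`, `∫(v_ℓ·∇)z̃ = 0` (`div v_ℓ = 0`) and
`∫(-Δ)^γ z̃ = 0`. [folklore] -/
theorem fracPotential_integral_transport (hab : a < b) (hγ : 0 < γ) (hℓ : Torus.IsFracNSReynoldsOn (Icc a b) γ ν vℓ pℓ Rℓ)
    (hv : Torus.IsFracNSReynoldsOn (Icc a b) γ ν v p (fun _ _ _ => 0))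
    (hwdef : ∀ t y, w t y = v t y - vℓ t y) (hZdef : ∀ t, Z t = BDSV.biotSavart (w t))
    {s : ℝ} (hs : s ∈ Icc a b) :
    ∫ y, (FunctionSpaces.Torus.timeDerivWithin (Icc a b) Z s y + FunctionSpaces.Torus.convect (vℓ s) (Z s) y + ν • Torus.fracLaplacian γ (Z s) y) = 0 := by
  have hU : UniqueDiffOn ℝ (Icc a b) := uniqueDiffOn_Icc hab
  have hws : FunctionSpaces.Torus.IsSmoothSpaceTimeOn (Icc a b) w := fracPotential_smooth_w hℓ hv hwdef
  have hZs : FunctionSpaces.Torus.IsSmoothSpaceTimeOn (Icc a b) Z := fracPotential_smooth_Z hab hℓ hv hwdef hZdef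
  have hZss : IsSmooth (Z s) := hZs.isSmooth_slice hs
  have hℓs : IsSmooth (vℓ s) := hℓ.smooth_velocity.isSmooth_slice hs
  have h1 : IsSmooth (FunctionSpaces.Torus.timeDerivWithin (Icc a b) Z s) := hZs.isSmooth_timeDerivWithin hU hs
  have h2 : IsSmooth (FunctionSpaces.Torus.convect (vℓ s) (Z s)) := hℓs.convect hZss
  have h3 : IsSmooth (Torus.fracLaplacian γ (Z s)) := hZss.fracLaplacian hγ.le
  -- `∫∂ₜz̃ = d/dt ∫z̃ = 0`
  have hint0 : ∀ t ∈ Icc a b, ∫ y, Z t y = 0 := fun t ht => by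
    rw [hZdef t]; exact integral_biotSavart (hws.isSmooth_slice ht)
  have hD : HasDerivWithinAt (fun t => ∫ y, Z t y) (∫ y, FunctionSpaces.Torus.timeDerivWithin (Icc a b) Z s y) (Icc a b) s :=
    hZs.hasDerivWithinAt_integral (convex_Icc a b) hs
  have hD0 : HasDerivWithinAt (fun t => ∫ y, Z t y) 0 (Icc a b) s :=
    (hasDerivWithinAt_const s (Icc a b) (0 : EuclideanSpace ℝ (Fin 3))).congr_of_mem (fun t ht => hint0 t ht) hs
  have e1 : ∫ y, FunctionSpaces.Torus.timeDerivWithin (Icc a b) Z s y = 0 := (hU s hs).eq_deriv _ hD hD0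
  have e2 : ∫ y, FunctionSpaces.Torus.convect (vℓ s) (Z s) y = 0 :=
    integral_fderiv_apply_eq_zero_of_isDivFree hℓs hZss (hℓ.divFree s hs)
  have e3 : ∫ y, Torus.fracLaplacian γ (Z s) y = 0 := Torus.integral_fracLaplacian_eq_zero hγ hZss
  have i1 : Integrable (fun y => FunctionSpaces.Torus.timeDerivWithin (Icc a b) Z s y) := h1.integrable
  have i2 : Integrable (fun y => FunctionSpaces.Torus.convect (vℓ s) (Z s) y) := h2.integrable
  have i3 : Integrable (fun y => ν • Torus.fracLaplacian γ (Z s) y) := h3.integrable.smul ν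
  have i12 : Integrable (fun y => FunctionSpaces.Torus.timeDerivWithin (Icc a b) Z s y + FunctionSpaces.Torus.convect (vℓ s) (Z s) y) :=
    i1.add i2
  rw [integral_add i12 i3, integral_add i1 i2, integral_smul, e1, e2, e3]
  simp

/-- **`div(∂ₜz̃ + (v_ℓ·∇)z̃ + ν(-Δ)^γ z̃) = div((z̃·∇)v_ℓ)`**: `div ∂ₜz̃ = 0`, `div (-Δ)^γ z̃ = 0` and
`div((v_ℓ·∇)z̃) = div((z̃·∇)v_ℓ)` (both fields divergence free). [cite: Derosa2018, §5.2 proof of Prop. 5.4] -/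
theorem fracPotential_divergence_transport (hab : a < b) (hγ : 0 < γ) (hℓ : Torus.IsFracNSReynoldsOn (Icc a b) γ ν vℓ pℓ Rℓ)
    (hv : Torus.IsFracNSReynoldsOn (Icc a b) γ ν v p (fun _ _ _ => 0))
    (hwdef : ∀ t y, w t y = v t y - vℓ t y) (hZdef : ∀ t, Z t = BDSV.biotSavart (w t))
    {s : ℝ} (hs : s ∈ Icc a b) (x : UnitAddTorus (Fin 3)) :
    FunctionSpaces.Torus.divergence (fun y => FunctionSpaces.Torus.timeDerivWithin (Icc a b) Z s y + FunctionSpaces.Torus.convect (vℓ s) (Z s) y + ν • Torus.fracLaplacian γ (Z s) y) x =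
      FunctionSpaces.Torus.divergence (FunctionSpaces.Torus.convect (Z s) (vℓ s)) x := by
  have hU : UniqueDiffOn ℝ (Icc a b) := uniqueDiffOn_Icc hab
  have hws : FunctionSpaces.Torus.IsSmoothSpaceTimeOn (Icc a b) w := fracPotential_smooth_w hℓ hv hwdef
  have hZs : FunctionSpaces.Torus.IsSmoothSpaceTimeOn (Icc a b) Z := fracPotential_smooth_Z hab hℓ hv hwdef hZdef
  have hZss : IsSmooth (Z s) := hZs.isSmooth_slice hs
  have hℓs : IsSmooth (vℓ s) := hℓ.smooth_velocity.isSmooth_slice hs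
  have h1 : IsSmooth (FunctionSpaces.Torus.timeDerivWithin (Icc a b) Z s) := hZs.isSmooth_timeDerivWithin hU hs
  have h2 : IsSmooth (FunctionSpaces.Torus.convect (vℓ s) (Z s)) := hℓs.convect hZss
  have h3 : IsSmooth (Torus.fracLaplacian γ (Z s)) := hZss.fracLaplacian hγ.le
  have h3' : IsSmooth (ν • Torus.fracLaplacian γ (Z s)) := h3.smul ν
  have hdivZ : ∀ t ∈ Icc a b, IsDivFree (Z t) := fun t ht => by
    rw [hZdef t]; exact isDivFree_biotSavart (hws.isSmooth_slice ht)
  rw [show (fun y => FunctionSpaces.Torus.timeDerivWithin (Icc a b) Z s y + FunctionSpaces.Torus.convect (vℓ s) (Z s) y + ν • Torus.fracLaplacian γ (Z s) y) =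
      (FunctionSpaces.Torus.timeDerivWithin (Icc a b) Z s + FunctionSpaces.Torus.convect (vℓ s) (Z s)) + ν • Torus.fracLaplacian γ (Z s) from rfl,
    divergence_add' ((h1.add h2).isContDiff (by simp)) (h3'.isContDiff (by simp)),
    divergence_add' (h1.isContDiff (by simp)) (h2.isContDiff (by simp)),
    Torus.divergence_timeDerivWithin_eq_zero hab hZs hdivZ hs x, zero_add,
    Torus.divergence_const_smul (h3.isContDiff (by simp)),
    divergence_convect_comm hℓs hZss (hℓ.divFree s hs) (hdivZ s hs) x]
  have e3 : FunctionSpaces.Torus.divergence (Torus.fracLaplacian γ (Z s)) x = 0 := by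
    rw [hZdef s]; exact divergence_fracLaplacian_biotSavart hγ.le (hws.isSmooth_slice hs) x
  rw [e3, mul_zero, add_zero]

/-- **The equation of the vector potential** (De Rosa, proof of Prop. 5.4, (5.27) after taking
`curl⁻¹ = ℬ`): for an exact solution `(vᵢ, pᵢ)` of the fractional Navier–Stokes system and a
fractional NSR triple `(v_ℓ, p_ℓ, R̊_ℓ)` on `[a,b] × 𝕋³` with `vᵢ(a) = v_ℓ(a)`, `γ > 0`, the potential
`z̃ = ℬw`, `w = vᵢ - v_ℓ`, satisfies
`∂ₜz̃ + (v_ℓ·∇)z̃ + ν(-Δ)^γ z̃ = -ℬ((w·∇)vᵢ) - ℬ(div R̊_ℓ) + ℬ(C₁) + ∇Δ⁻¹div((z̃·∇)v_ℓ)`,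
`C₁ = curl((v_ℓ·∇)z̃) - (v_ℓ·∇)(curl z̃)` (the pressure drops out: `ℬ∇ = 0`). [cite: Derosa2018, §5.2 proof of Prop. 5.4 ((5.26)–(5.27))] -/
theorem fracPotential_transport_eq (hab : a < b) (hγ : 0 < γ) (hℓ : Torus.IsFracNSReynoldsOn (Icc a b) γ ν vℓ pℓ Rℓ)
    (hv : Torus.IsFracNSReynoldsOn (Icc a b) γ ν v p (fun _ _ _ => 0)) (hanchor : v a = vℓ a)
    (hwdef : ∀ t y, w t y = v t y - vℓ t y) (hZdef : ∀ t, Z t = BDSV.biotSavart (w t))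
    {s : ℝ} (hs : s ∈ Icc a b) (x : UnitAddTorus (Fin 3)) :
    FunctionSpaces.Torus.timeDerivWithin (Icc a b) Z s x + FunctionSpaces.Torus.convect (vℓ s) (Z s) x + ν • Torus.fracLaplacian γ (Z s) x =
      -(BDSV.biotSavart (FunctionSpaces.Torus.convect (w s) (v s)) x) - BDSV.biotSavart (Torus.tensorDivergence (Rℓ s)) x +
        BDSV.biotSavart (fun y => BDSV.curl (FunctionSpaces.Torus.convect (vℓ s) (Z s)) y - FunctionSpaces.Torus.convect (vℓ s) (BDSV.curl (Z s)) y) x +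
        Torus.gradient (FunctionSpaces.Torus.invLaplacian (FunctionSpaces.Torus.divergence (FunctionSpaces.Torus.convect (Z s) (vℓ s)))) x := by
  have hU : UniqueDiffOn ℝ (Icc a b) := uniqueDiffOn_Icc hab
  have hws : FunctionSpaces.Torus.IsSmoothSpaceTimeOn (Icc a b) w := fracPotential_smooth_w hℓ hv hwdef
  have hZs : FunctionSpaces.Torus.IsSmoothSpaceTimeOn (Icc a b) Z := fracPotential_smooth_Z hab hℓ hv hwdef hZdef
  have hZss : IsSmooth (Z s) := hZs.isSmooth_slice hs
  have hwss : IsSmooth (w s) := hws.isSmooth_slice hs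
  have hℓs : IsSmooth (vℓ s) := hℓ.smooth_velocity.isSmooth_slice hs
  have hvs : IsSmooth (v s) := hv.smooth_velocity.isSmooth_slice hs
  have hps : IsSmooth (p s) := hv.smooth_pressure.isSmooth_slice hs
  have hpℓs : IsSmooth (pℓ s) := hℓ.smooth_pressure.isSmooth_slice hs
  have hRs : IsSmooth (Rℓ s) := hℓ.smooth_stress.isSmooth_slice hs
  have h1 : IsSmooth (FunctionSpaces.Torus.timeDerivWithin (Icc a b) Z s) := hZs.isSmooth_timeDerivWithin hU hs
  have h2 : IsSmooth (FunctionSpaces.Torus.convect (vℓ s) (Z s)) := hℓs.convect hZss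
  have h3 : IsSmooth (Torus.fracLaplacian γ (Z s)) := hZss.fracLaplacian hγ.le
  -- the transported field `Y`
  set Y : UnitAddTorus (Fin 3) → EuclideanSpace ℝ (Fin 3) := fun y =>
    FunctionSpaces.Torus.timeDerivWithin (Icc a b) Z s y + FunctionSpaces.Torus.convect (vℓ s) (Z s) y + ν • Torus.fracLaplacian γ (Z s) y with hY
  have hYs : IsSmooth Y := (h1.add h2).add (h3.smul ν)
  have recon := eq_biotSavart_curl_add hYs x
  rw [fracPotential_integral_transport hab hγ hℓ hv hwdef hZdef hs, zero_add] at recon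
  -- `curl Y` through the transport equation of `w`
  have hE := fracStability_transport_eq hab hγ.le hℓ hv s hs
  have hcurlY : BDSV.curl Y = (-(FunctionSpaces.Torus.convect (w s) (v s)) - Torus.gradient (fun y => p s y - pℓ s y) - Torus.tensorDivergence (Rℓ s)) +
      fun y => BDSV.curl (FunctionSpaces.Torus.convect (vℓ s) (Z s)) y - FunctionSpaces.Torus.convect (vℓ s) (BDSV.curl (Z s)) y := by
    funext y
    rw [hY, fracPotential_curl_transport hab hγ hℓ hv hanchor hwdef hZdef hs y]
    have hwfun : w = fun t y => v t y - vℓ t y := fracPotential_w_eq hwdef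
    have hEy := hE y
    rw [← hwfun, show (fun y => v s y - vℓ s y) = w s from by rw [hwfun]] at hEy
    rw [hEy]
    simp only [Pi.add_apply, Pi.sub_apply, Pi.neg_apply]
  -- `div Y`
  have hdivY : FunctionSpaces.Torus.divergence Y = FunctionSpaces.Torus.divergence (FunctionSpaces.Torus.convect (Z s) (vℓ s)) :=
    funext fun y => fracPotential_divergence_transport hab hγ hℓ hv hwdef hZdef hs y
  -- smoothness of the pieces of `curl Y`
  have hA : IsSmooth (FunctionSpaces.Torus.convect (w s) (v s)) := hwss.convect hvs
  have hG : IsSmooth (Torus.gradient (fun y => p s y - pℓ s y)) := (hps.sub hpℓs).gradient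
  have hT : IsSmooth (Torus.tensorDivergence (Rℓ s)) := hRs.tensorDivergence
  have hC : IsSmooth (fun y => BDSV.curl (FunctionSpaces.Torus.convect (vℓ s) (Z s)) y - FunctionSpaces.Torus.convect (vℓ s) (BDSV.curl (Z s)) y) :=
    (isSmooth_curl h2).sub (hℓs.convect (isSmooth_curl hZss))
  have hB : BDSV.biotSavart (BDSV.curl Y) x = -(BDSV.biotSavart (FunctionSpaces.Torus.convect (w s) (v s)) x) - BDSV.biotSavart (Torus.tensorDivergence (Rℓ s)) x +
      BDSV.biotSavart (fun y => BDSV.curl (FunctionSpaces.Torus.convect (vℓ s) (Z s)) y - FunctionSpaces.Torus.convect (vℓ s) (BDSV.curl (Z s)) y) x := by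
    have hBG : BDSV.biotSavart (Torus.gradient fun y => p s y - pℓ s y) = 0 := biotSavart_gradient (hps.sub hpℓs)
    rw [hcurlY, biotSavart_add ((hA.neg.sub hG).sub hT) hC, Pi.add_apply, biotSavart_sub (hA.neg.sub hG) hT, Pi.sub_apply,
      biotSavart_sub hA.neg hG, Pi.sub_apply, biotSavart_neg hA, Pi.neg_apply, hBG]
    simp
  have hfinal : Y x = -(BDSV.biotSavart (FunctionSpaces.Torus.convect (w s) (v s)) x) - BDSV.biotSavart (Torus.tensorDivergence (Rℓ s)) x +
      BDSV.biotSavart (fun y => BDSV.curl (FunctionSpaces.Torus.convect (vℓ s) (Z s)) y - FunctionSpaces.Torus.convect (vℓ s) (BDSV.curl (Z s)) y) x +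
        Torus.gradient (FunctionSpaces.Torus.invLaplacian (FunctionSpaces.Torus.divergence (FunctionSpaces.Torus.convect (Z s) (vℓ s)))) x := by
    rw [recon, hB, hdivY]
  simpa [hY] using hfinal

end DeRosa

end Literature.Analysis.FluidPDE
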